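import Summits.AtomisticToContinuum.Crystallization.Theorems.PricedLinkCensusTruncatedCensusGapFarPeriodicForm
import Summits.AtomisticToContinuum.Crystallization.Theorems.PricedLinkCensusTruncatedCensusGapFarSeparatedReduction
import Summits.AtomisticToContinuum.Crystallization.Theorems.PricedLinkCensusTruncatedCensusGapGapOfSeparatedPeriodicPricing

/-!
# The Barlow far-site gap (FAR) is EXACTLY a periodic far-site pricing of UNIFORMLY SEPARATED periodic configurations

Helper (FAR-SEPARATED PERIODIC FORM) for the stub `stub_barlowFarSiteGap` (FAR, the open core)
of the line `near-far-split` (`Cruxes/TruncatedCensusGap/Lines/near_far_split.lean`) of the crux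
`PricedLinkCensus.TruncatedCensusGap` (item stmt-AtomisticToContinuum-14230); the FAR-twin of
c3's `truncatedCensusGap_iff_separatedPeriodicPricing` (`…SeparatedPeriodicForm.lean`).
Composition of the landed FAR-PERIODIC FORM (`farSiteGap_iff_periodicFarPricing`,
`motifFar_periodiseFar`, `…FarPeriodicForm.lean`), the landed FAR-SEPARATED REDUCTION
(`farSiteGap_of_separatedDense`, `…FarSeparatedReduction.lean`) and the separation of the far
periodisation (`separated_points_periodiseFar`, `…GapOfSeparatedPeriodicPricing.lean`).

`farSiteGap_iff_separatedPeriodicFarPricing` — **(FAR) is EQUIVALENT to the periodic far-site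
pricing demanded ONLY of UNIFORMLY `1/4`-SEPARATED periodic configurations**:
`(FAR) ↔ ∃ κ > 0, ∀ Q : PeriodicConfiguration 3, (points of Q pairwise ≥ 1/4 apart) →
κ · #{motif sites of Q far in Q.points} ≤ #F · (e_χ(Q) − e_χ*)`.
This is the most compact form of the open core of the line: a statement about the compact
strata (bounded local complexity) of Blanc–Lewin's periodic universe only — "a uniformly
discrete periodic configuration of `ℝ³` pays, above the periodic `V_χ`-infimum and uniformly in
the motif size, a fixed price per site whose `a/2`-separated closed `3a`-patch is not two-way
`a/50`-close to a rigidly moved Barlow stacking with `a ∈ [0.93, 1.02]`, `c/a ∈ [0.78, 0.86]`".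
Stratified by motif size `#F = n` it is a family of finite-dimensional inequalities with a
UNIFORM price; the uniformity in `n` is the open content (finite-range periodic crystallization
for `V_χ`, coarse priced form).

All `[folklore]` bookkeeping; the content of (FAR) is untouched.
-/

noncomputable section

namespace Summit.AtomisticToContinuum.Crystallization.Theorems.PricedLinkCensusTruncatedCensusGap

open Literature.MathematicalPhysics.StatisticalMechanics Literature.Geometry.DiscreteGeometry
open Summit.AtomisticToContinuum.Crystallization.Theorems.ChargedEnergyGapNegative

/-- **Periodic far-site pricing for `1/4`-separated periodic configurations implies (FAR).**
The far periodisation of a `1/4`-separated finite injective configuration `y` (`N ≥ 1`) is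
`1/4`-separated (`separated_points_periodiseFar`), has the far sites of `y` as its far motif
sites (`motifFar_periodiseFar`) and energy per particle `E_χ(y)/N`
(`energyPerParticle_periodiseFar_eq_div`), so separated (dense) configurations are priced, and
the compact-strata reduction `farSiteGap_of_separatedDense` does the rest. [folklore] -/
theorem farSiteGap_of_separatedPeriodicFarPricing : (∃ κ : ℝ, 0 < κ ∧ ∀ Q : Literature.MathematicalPhysics.StatisticalMechanics.PeriodicConfiguration 3, (∀ p ∈ Q.points, ∀ q ∈ Q.points, p ≠ q → 1 / 4 ≤ dist p q) → κ * (Nat.card {x : Q.motif // ¬ ∃ (a c : ℝ) (s : ℤ → ℤ) (g : EuclideanSpace ℝ (Fin 3) ≃ᵃⁱ[ℝ] EuclideanSpace ℝ (Fin 3)), 93 / 100 ≤ a ∧ a ≤ 51 / 50 ∧ 78 / 100 * a ≤ c ∧ c ≤ 86 / 100 * a ∧ Literature.MathematicalPhysics.StatisticalMechanics.IsHaggSeq s ∧ (∀ j k : Q.points, j ≠ k → dist ((Subtype.val : Q.points → EuclideanSpace ℝ (Fin 3)) j) ((Subtype.val : Q.points → EuclideanSpace ℝ (Fin 3)) ⟨x.1,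 Q.mem_points_of_mem_motif x.2⟩) ≤ 3 * a → a / 2 ≤ dist ((Subtype.val : Q.points → EuclideanSpace ℝ (Fin 3)) j) ((Subtype.val : Q.points → EuclideanSpace ℝ (Fin 3)) k)) ∧ (∀ j : Q.points, dist ((Subtype.val : Q.points → EuclideanSpace ℝ (Fin 3)) j) ((Subtype.val : Q.points → EuclideanSpace ℝ (Fin 3)) ⟨x.1, Q.mem_points_of_mem_motif x.2⟩) ≤ 3 * a → ∃ z ∈ Literature.MathematicalPhysics.StatisticalMechanics.barlowStacking a c s, dist ((Subtype.val : Q.points → EuclideanSpace ℝ (Fin 3)) j) (g z) ≤ a / 50) ∧ (∀ z ∈ Literature.MathematicalPhysics.StatisticalMechanics.barlowStacking a c s, dist (g z) ((Subtype.val : Q.points → EuclideanSpace ℝ (Fin 3)) ⟨x.1, Q.mem_points_of_mem_motif x.2⟩) ≤ 3 * a → ∃ j : Q.points, dist ((Subtype.val : Q.points → EuclideanSpace ℝ (Fin 3)) j) (g z) ≤ a / 50)} : ℝ) ≤ (Q.motif.card : ℝ) * (Q.energyPerParticle (fun r => min 1 (max 0 (4 - 2 * r)) * Literature.MathematicalPhysics.StatisticalMechanics.lennardJones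 r) - ⨅ Q' : Literature.MathematicalPhysics.StatisticalMechanics.PeriodicConfiguration 3, Q'.energyPerParticle (fun r => min 1 (max 0 (4 - 2 * r)) * Literature.MathematicalPhysics.StatisticalMechanics.lennardJones r))) → (∃ κ : ℝ, 0 < κ ∧ ∀ (N : ℕ) (y : Fin N → EuclideanSpace ℝ (Fin 3)), Function.Injective y → (N : ℝ) * (⨅ Q : Literature.MathematicalPhysics.StatisticalMechanics.PeriodicConfiguration 3, Q.energyPerParticle (fun r => min 1 (max 0 (4 - 2 * r)) * Literature.MathematicalPhysics.StatisticalMechanics.lennardJones r)) + κ * (Nat.card {i : Fin N // ¬ ∃ (a c : ℝ) (s : ℤ → ℤ) (g : EuclideanSpace ℝ (Fin 3) ≃ᵃⁱ[ℝ] EuclideanSpace ℝ (Fin 3)), 93 / 100 ≤ a ∧ a ≤ 51 / 50 ∧ 78 / 100 * a ≤ c ∧ c ≤ 86 / 100 * a ∧ Literature.MathematicalPhysics.StatisticalMechanics.IsHaggSeq s ∧ (∀ j k : Fin N, j ≠ k → dist (y j) (y i) ≤ 3 * a → a / 2 ≤ dist (y j) (y k)) ∧ (∀ j : Fin N, dist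 (y j) (y i) ≤ 3 * a → ∃ z ∈ Literature.MathematicalPhysics.StatisticalMechanics.barlowStacking a c s, dist (y j) (g z) ≤ a / 50) ∧ (∀ z ∈ Literature.MathematicalPhysics.StatisticalMechanics.barlowStacking a c s, dist (g z) (y i) ≤ 3 * a → ∃ j : Fin N, dist (y j) (g z) ≤ a / 50)} : ℝ) ≤ Literature.MathematicalPhysics.StatisticalMechanics.interactionEnergy (fun r => min 1 (max 0 (4 - 2 * r)) * Literature.MathematicalPhysics.StatisticalMechanics.lennardJones r) y) := by
  rintro ⟨κ, hκ, h⟩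
  refine farSiteGap_of_separatedDense ⟨κ, hκ, ?_⟩
  intro N y hy hsep _hdense
  rcases Nat.eq_zero_or_pos N with rfl | hN0
  · rw [Nat.card_of_isEmpty, interactionEnergy_of_subsingleton]
    simp
  · have hp := h (periodiseFar y hN0) (separated_points_periodiseFar hN0 hsep)
    rw [motifFar_periodiseFar hy hN0] at hp
    have hcard : (((periodiseFar y hN0).motif.card : ℕ) : ℝ) = N := by
      rw [motif_periodiseFar, Finset.card_image_of_injective _ hy, Finset.card_univ,
        Fintype.card_fin]
    have he : (periodiseFar y hN0).energyPerParticle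
        (fun r => min 1 (max 0 (4 - 2 * r)) * lennardJones r) =
        interactionEnergy (fun r => min 1 (max 0 (4 - 2 * r)) * lennardJones r) y / N :=
      energyPerParticle_periodiseFar_eq_div truncLJ_eq_zero_of_two_le (by norm_num) hy hN0
    rw [hcard, he] at hp
    generalize (Nat.card {i : Fin N // ¬ ∃ (a c : ℝ) (s : ℤ → ℤ) (g : EuclideanSpace ℝ (Fin 3) ≃ᵃⁱ[ℝ] EuclideanSpace ℝ (Fin 3)), 93 / 100 ≤ a ∧ a ≤ 51 / 50 ∧ 78 / 100 * a ≤ c ∧ c ≤ 86 / 100 * a ∧ Literature.MathematicalPhysics.StatisticalMechanics.IsHaggSeq s ∧ (∀ j k : Fin N, j ≠ k → dist (y j) (y i) ≤ 3 * a → a / 2 ≤ dist (y j) (y k)) ∧ (∀ j : Fin N, dist (y j) (y i) ≤ 3 * a → ∃ z ∈ Literature.MathematicalPhysics.StatisticalMechanics.barlowStacking a c s, dist (y j) (g z) ≤ a / 50) ∧ (∀ z ∈ Literature.MathematicalPhysics.StatisticalMechanics.barlowStacking a c s, dist (g z) (y i) ≤ 3 * a → ∃ j : Fin N, dist (y j)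 (g z) ≤ a / 50)} : ℝ) = m at hp ⊢
    generalize interactionEnergy (fun r => min 1 (max 0 (4 - 2 * r)) * lennardJones r) y = E
      at hp ⊢
    have hNr : (0 : ℝ) < N := by exact_mod_cast hN0
    have hmul : (N : ℝ) * (E / N) = E := by field_simp
    rw [mul_sub, hmul] at hp
    linarith

/-- **(FAR) is EQUIVALENT to the periodic far-site pricing for uniformly `1/4`-separated periodic
configurations** ((FAR) ⇒ pricing of every periodic `Q` by the periodic form
`farSiteGap_iff_periodicFarPricing`, in particular of the separated ones; conversely
`farSiteGap_of_separatedPeriodicFarPricing`): the compact-strata form of the open core of the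
line `near-far-split`. [folklore] -/
theorem farSiteGap_iff_separatedPeriodicFarPricing : (∃ κ : ℝ, 0 < κ ∧ ∀ (N : ℕ) (y : Fin N → EuclideanSpace ℝ (Fin 3)), Function.Injective y → (N : ℝ) * (⨅ Q : Literature.MathematicalPhysics.StatisticalMechanics.PeriodicConfiguration 3, Q.energyPerParticle (fun r => min 1 (max 0 (4 - 2 * r)) * Literature.MathematicalPhysics.StatisticalMechanics.lennardJones r)) + κ * (Nat.card {i : Fin N // ¬ ∃ (a c : ℝ) (s : ℤ → ℤ) (g : EuclideanSpace ℝ (Fin 3) ≃ᵃⁱ[ℝ] EuclideanSpace ℝ (Fin 3)), 93 / 100 ≤ a ∧ a ≤ 51 / 50 ∧ 78 / 100 * a ≤ c ∧ c ≤ 86 / 100 * a ∧ Literature.MathematicalPhysics.StatisticalMechanics.IsHaggSeq s ∧ (∀ j k : Fin N, j ≠ k → dist (y j) (y i) ≤ 3 * a → a / 2 ≤ dist (y j) (y k)) ∧ (∀ j : Fin N, dist (y j) (y i) ≤ 3 * a → ∃ z ∈ Literature.MathematicalPhysics.StatisticalMechanics.barlowStacking a c s, dist (y j) (g z) ≤ a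 / 50) ∧ (∀ z ∈ Literature.MathematicalPhysics.StatisticalMechanics.barlowStacking a c s, dist (g z) (y i) ≤ 3 * a → ∃ j : Fin N, dist (y j) (g z) ≤ a / 50)} : ℝ) ≤ Literature.MathematicalPhysics.StatisticalMechanics.interactionEnergy (fun r => min 1 (max 0 (4 - 2 * r)) * Literature.MathematicalPhysics.StatisticalMechanics.lennardJones r) y) ↔ (∃ κ : ℝ, 0 < κ ∧ ∀ Q : Literature.MathematicalPhysics.StatisticalMechanics.PeriodicConfiguration 3, (∀ p ∈ Q.points, ∀ q ∈ Q.points, p ≠ q → 1 / 4 ≤ dist p q) → κ * (Nat.card {x : Q.motif // ¬ ∃ (a c : ℝ) (s : ℤ → ℤ) (g : EuclideanSpace ℝ (Fin 3) ≃ᵃⁱ[ℝ] EuclideanSpace ℝ (Fin 3)), 93 / 100 ≤ a ∧ a ≤ 51 / 50 ∧ 78 / 100 * a ≤ c ∧ c ≤ 86 / 100 * a ∧ Literature.MathematicalPhysics.StatisticalMechanics.IsHaggSeq s ∧ (∀ j k : Q.points, j ≠ k → dist ((Subtype.val : Q.points → EuclideanSpace ℝ (Fin 3)) j) ((Subtype.val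 : Q.points → EuclideanSpace ℝ (Fin 3)) ⟨x.1, Q.mem_points_of_mem_motif x.2⟩) ≤ 3 * a → a / 2 ≤ dist ((Subtype.val : Q.points → EuclideanSpace ℝ (Fin 3)) j) ((Subtype.val : Q.points → EuclideanSpace ℝ (Fin 3)) k)) ∧ (∀ j : Q.points, dist ((Subtype.val : Q.points → EuclideanSpace ℝ (Fin 3)) j) ((Subtype.val : Q.points → EuclideanSpace ℝ (Fin 3)) ⟨x.1, Q.mem_points_of_mem_motif x.2⟩) ≤ 3 * a → ∃ z ∈ Literature.MathematicalPhysics.StatisticalMechanics.barlowStacking a c s, dist ((Subtype.val : Q.points → EuclideanSpace ℝ (Fin 3)) j) (g z) ≤ a / 50) ∧ (∀ z ∈ Literature.MathematicalPhysics.StatisticalMechanics.barlowStacking a c s, dist (g z) ((Subtype.val : Q.points → EuclideanSpace ℝ (Fin 3)) ⟨x.1, Q.mem_points_of_mem_motif x.2⟩) ≤ 3 * a → ∃ j : Q.points, dist ((Subtype.val : Q.points → EuclideanSpace ℝ (Fin 3)) j) (g z) ≤ a / 50)} : ℝ) ≤ (Q.motif.card : ℝ) * (Q.energyPerParticle (fun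 r => min 1 (max 0 (4 - 2 * r)) * Literature.MathematicalPhysics.StatisticalMechanics.lennardJones r) - ⨅ Q' : Literature.MathematicalPhysics.StatisticalMechanics.PeriodicConfiguration 3, Q'.energyPerParticle (fun r => min 1 (max 0 (4 - 2 * r)) * Literature.MathematicalPhysics.StatisticalMechanics.lennardJones r))) :=
  ⟨fun h => by
    obtain ⟨κ, hκ, hp⟩ := periodicFarPricing_of_farSiteGap h
    exact ⟨κ, hκ, fun Q _ => hp Q⟩,
   farSiteGap_of_separatedPeriodicFarPricing⟩

end Summit.AtomisticToContinuum.Crystallization.Theorems.PricedLinkCensusTruncatedCensusGap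

end
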